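import Literature.Computability.Cryptography.TreeSigDistinguisher
import HarnessLib

/-!
# The authentication-tree scheme, V: what the distinguisher computes

Topic `Literature/Computability/Cryptography`; continues `TreeSigDistinguisher.lean` (the machines `EM`, `resD`,
`GD`, `distinguisher`). We prove that the distinguisher's verdict IS the forgery event of the emulated attack:

* length bookkeeping (`Bounds`): a polynomial bound `A` on node keys (from the efficiency of `G`), a bound `PS` on
  one-time signatures (hypothesis `SigBound` — the signatures of the one-time scheme do not grow with the document,
  as for hash-and-sign over Lamport), the output-length polynomial `RA` of the forger; the derived bounds on
  signatures (`length_sigGI_le`), on the forger's queries in any indexed run whose answers are short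
  (`length_le_of_mem_queriesIdxAux`), and the three resource polynomials `PcOf`, `cOf`, `ROf` of the emulation;
* **`resD_eq`** — on `w = ⟨⟨1ⁿ, r⟩, listBool blocks⟩` with a well-formed table, the emulation result is
  `⟨w_out, listBool records⟩` where the records are `⟨αᵢ, sigᵢ⟩` over the queries of `𝒜` in the indexed attack
  against the table signer `i, α ↦ sigG (tabFun n i blocks) α (blk n i ρ)`, and `w_out` codes its output;
* **`GD_eq`** — hence `GD w = [ForgeWith P 𝒜 n pk_ε (table signer) r_A]`;
* **`run_distinguisher`** — against an oracle answering `(n+1)`-bit queries with `R(n)`-bit blocks, `D` on `⟨1ⁿ, r⟩`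
  accepts iff `ForgeWith P 𝒜 n (pkOf (O (code ε))) (i, α ↦ sigG (O ∘ code n) α (blk n i ρ)) r_A` (the table read
  through `pos` IS `O ∘ code n` on every label the attack touches: `tabFun_fetched`).

All statements proved; no named facts.

## References

* O. Goldreich, *Foundations of Cryptography II: Basic Applications*, CUP 2004, §6.4.2.3, proof of Prop. 6.4.17.
-/

namespace Literature.Computability.Cryptography

open _root_.Computability Complexity Complexity.Brick Polynomial
open Complexity.Plumb Complexity.OracleCompose Complexity.HashBricks Complexity.OracleAlg

namespace TreeSig

variable (P : Spec) (𝒜 : OracleAdversary (List Bool × List Bool))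

/-! ### Length bookkeeping -/

/-- **One-time signatures of bounded length**: under keys of `G(1ⁿ)` and with coins of the prescribed length, every
signature has length `≤ PS(n)`, whatever the document (true of hash-and-sign over Lamport, whose signatures consist of a
hash index and `ℓ(n)` preimages). [Goldreich 2004, Construction 6.4.30 with Construction 6.4.4] [folklore] -/
def SigBound (S : SignatureScheme) (PS : Polynomial ℕ) : Prop :=
  ∀ n, ∀ ks ∈ (S.keyPMF n).support, ∀ m ρ : List Bool, ρ.length = S.sign.coinLen (pairCode (ks.2, m)).length →
    (S.sign.run (ks.2, m) ρ).length ≤ PS.eval n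

/-- The length bounds used by the emulation: `A` on node keys, `PS` on one-time signatures, `RA` on the forger's step
outputs. [folklore] -/
structure Bounds where
  /-- bound on node verification keys -/
  A : Polynomial ℕ
  /-- bound on one-time signatures -/
  PS : Polynomial ℕ
  /-- output-length polynomial of the forger's step function -/
  RA : Polynomial ℕ

namespace Bounds

variable {P 𝒜} (B : Bounds)

/-- The bounds hold. [folklore] -/
structure OK (P : Spec) (𝒜 : OracleAdversary (List Bool × List Bool)) (B : Bounds) : Prop where
  /-- every node key is short -/
  hA : ∀ (n : ℕ) (b : List Bool), (pkOf P n b).length ≤ B.A.eval n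
  /-- one-time signatures are short -/
  hPS : SigBound P.S B.PS
  /-- the forger's step outputs are polynomially bounded -/
  hRA : ∀ (x : List Bool) (ans : List (List Bool)),
    (((encodingList Bool).sumBool ((encodingList Bool).pairBool (encodingList Bool))).encode (𝒜.alg.step x ans)).length ≤
      B.RA.eval (boolPair x ((encodingList Bool).listBool.encode ans)).length

/-- Bound on a node-interface signature: the leaf and `3n + 1` items of length `≤ A + PS`. [folklore] -/
noncomputable def Lsig : Polynomial ℕ := 2 * X + 2 + (3 * X + 1) * (2 * (B.A + B.PS) + 2)

/-- Bound on the code of the answers to at most `TA(n)` queries. [folklore] -/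
noncomputable def Lans (P : Spec) (𝒜 : OracleAdversary (List Bool × List Bool)) : Polynomial ℕ :=
  2 * TAPoly P 𝒜 + 2 + TAPoly P 𝒜 * (2 * B.Lsig + 2)

/-- Bound on the length of the forger's step input `⟨⟨xA, r_A⟩, listBool answers⟩`. [folklore] -/
noncomputable def Lstep (P : Spec) (𝒜 : OracleAdversary (List Bool × List Bool)) : Polynomial ℕ :=
  4 * ℓxPoly P + 6 + 2 * cAPoly P 𝒜 + B.Lans P 𝒜

/-- Bound on the forger's queries. [folklore] -/
noncomputable def Lq (P : Spec) (𝒜 : OracleAdversary (List Bool × List Bool)) : Polynomial ℕ := B.RA.comp (B.Lstep P 𝒜)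

/-- The clip of the chain loop: `4A + 2PS + 6`. [folklore] -/
noncomputable def PcOf : Polynomial ℕ := 4 * B.A + 2 * B.PS + 6

/-- The query cap of the emulation: tagged queries `⟨1ⁱ, α⟩`, `i < TA`. [folklore] -/
noncomputable def cOf (P : Spec) (𝒜 : OracleAdversary (List Bool × List Bool)) : Polynomial ℕ := 2 * TAPoly P 𝒜 + 2 + B.Lq P 𝒜

/-- The round budget of the emulation: `TA + 1`. [folklore] -/
noncomputable def ROf (P : Spec) (𝒜 : OracleAdversary (List Bool × List Bool)) : Polynomial ℕ := TAPoly P 𝒜 + 1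

end Bounds

variable {P 𝒜}

/-- **Existence of the bounds** for an efficient one-time scheme with bounded signatures and a PPT forger.
[Arora–Barak 2009, §1.2 (a polynomial-time machine writes polynomially many symbols)] [folklore] -/
theorem exists_bounds (hK : P.S.keyGen.IsPolyTime unaryEncodeNat pairCode) {PS : Polynomial ℕ} (hPS : SigBound P.S PS)
    (h𝒜 : 𝒜.IsPPT ((encodingList Bool).pairBool (encodingList Bool))) : ∃ B : Bounds, B.OK P 𝒜 := by
  obtain ⟨s, hs⟩ := exists_poly_length_le_of_mem_FP' (SigOWF.kgFn_mem_FP (P := ctx P) hK.1)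
  obtain ⟨RA, hRA⟩ := h𝒜.exists_length_le
  refine ⟨⟨s.comp (2 * X + 2 + P.pG), PS, RA⟩, ⟨fun n b => ?_, hPS, hRA⟩⟩
  have h := hs (boolPair (ones n) (b.take (P.pG.eval n)))
  rw [SigOWF.kgFn_boolPair, List.length_replicate] at h
  change (pairCode (keyOf P n b)).length ≤ _ at h
  have hpk : (pkOf P n b).length ≤ (pairCode (keyOf P n b)).length := by
    rw [pkOf, ← fstF_pairCode (keyOf P n b)]
    have := length_fstF_sndF_le (pairCode (keyOf P n b)); omega
  refine hpk.trans (h.trans ?_)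
  rw [eval_comp]
  refine TM2Iter.eval_mono s ?_
  simp only [length_boolPair, List.length_replicate, List.length_take, eval_add, eval_mul, eval_ofNat, eval_X]
  omega

/-- The coded list of strings of length `≤ M` has length `≤ |l| (2M + 2)`. [folklore] -/
theorem length_encList_le {M : ℕ} : ∀ l : List (List Bool), (∀ a ∈ l, a.length ≤ M) → (encList l).length ≤ l.length * (2 * M + 2)
  | [], _ => by simp
  | a :: l, h => by
    rw [encList_cons, length_boolPair, List.length_cons, add_mul, one_mul]
    have ha := h a (by simp)
    have hl := length_encList_le l fun b hb => h b (by simp [hb])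
    omega

/-- Items of the chain are short when keys and signatures are. [folklore] -/
theorem length_le_of_mem_chainItems {pkN : List Bool → List Bool} {sgN : List Bool → List Bool → List Bool} {A S : ℕ}
    (hpk : ∀ L, (pkN L).length ≤ A) (hsg : ∀ L m, (sgN L m).length ≤ S) :
    ∀ (pre σ : List Bool), ∀ a ∈ chainItems pkN sgN pre σ, a.length ≤ A + S
  | _, [], a, h => by simp [chainItems] at h
  | pre, b :: σ, a, h => by
    simp only [chainItems, List.mem_cons] at h
    rcases h with rfl | rfl | rfl | h
    · exact (hpk _).trans (Nat.le_add_right _ _)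
    · exact (hpk _).trans (Nat.le_add_right _ _)
    · exact (hsg _ _).trans (Nat.le_add_left _ _)
    · exact length_le_of_mem_chainItems hpk hsg _ σ a h

/-- **Node-interface signatures are short**: `|sigGI pkN sgN α σ| ≤ Lsig(n)` for `|σ| ≤ n`. [folklore] -/
theorem length_sigGI_le (B : Bounds) {pkN : List Bool → List Bool} {sgN : List Bool → List Bool → List Bool} {n : ℕ}
    (hpk : ∀ L, (pkN L).length ≤ B.A.eval n) (hsg : ∀ L m, (sgN L m).length ≤ B.PS.eval n) (α : List Bool) {σ : List Bool}
    (hσ : σ.length ≤ n) : (sigGI pkN sgN α σ).length ≤ B.Lsig.eval n := by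
  have hitems : ∀ a ∈ chainG pkN sgN α [] σ, a.length ≤ B.A.eval n + B.PS.eval n := by
    intro a ha
    simp only [chainG, List.mem_append, List.mem_singleton] at ha
    rcases ha with ha | rfl
    · exact length_le_of_mem_chainItems hpk hsg [] σ a ha
    · exact (hsg _ _).trans (Nat.le_add_left _ _)
  have hlen : (chainG pkN sgN α [] σ).length = 3 * σ.length + 1 := by
    rw [chainG, List.length_append, length_chainItems, List.length_singleton]
  have h := length_encList_le _ hitems
  rw [hlen] at h
  rw [sigGI, encList_cons, length_boolPair, Bounds.Lsig]
  simp only [eval_add, eval_mul, eval_ofNat, eval_X, eval_one]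
  have h3 : (3 * σ.length + 1) * (2 * (B.A.eval n + B.PS.eval n) + 2) ≤ (3 * n + 1) * (2 * (B.A.eval n + B.PS.eval n) + 2) :=
    Nat.mul_le_mul_right _ (by omega)
  omega

/-- **Queries of an indexed run with short answers are short.** If every answer `O i q` has length `≤ La` and the code
of each step output of `M` is bounded by `R` of the step input, then from a transcript of answers of length `≤ La` every
query asked within the next `k` rounds (total rounds `≤ T`) has length `≤ R(2|x| + 2 + (2T + 2 + T(2 La + 2)))`.
[Arora–Barak 2009, §1.2] [folklore] -/
theorem length_le_of_mem_queriesIdxAux {β : Type} {eb : Encoding β Bool} (M : OracleAlg β) {R : Polynomial ℕ}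
    (hR : ∀ x ans, (((encodingList Bool).sumBool eb).encode (M.step x ans)).length ≤ R.eval (boolPair x ((encodingList Bool).listBool.encode ans)).length)
    (O : ℕ → List Bool → List Bool) {La : ℕ} {T : ℕ} (hO : ∀ i < T, ∀ q, (O i q).length ≤ La) (x : List Bool) :
    ∀ (k : ℕ) (as : List (List Bool)), as.length + k ≤ T → (∀ a ∈ as, a.length ≤ La) →
      ∀ q ∈ M.queriesIdxAux O x k as, q.length ≤ R.eval (2 * x.length + 2 + (2 * T + 2 + T * (2 * La + 2)))
  | 0, _, _, _, q, hq => by simp [queriesIdxAux] at hq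
  | k + 1, as, hk, has, q, hq => by
    rw [queriesIdxAux] at hq
    cases hs : M.step x as with
    | inr b => rw [hs] at hq; simp at hq
    | inl y =>
      rw [hs] at hq
      rcases List.mem_cons.1 hq with rfl | hq
      · have h1 := hR x as
        rw [hs] at h1
        have h2 : (((encodingList Bool).sumBool eb).encode (Sum.inl q : List Bool ⊕ β)).length = q.length + 1 := by
          simp [Encoding.sumBool]; rfl
        rw [h2] at h1
        have h3 : (boolPair x ((encodingList Bool).listBool.encode as)).length ≤ 2 * x.length + 2 + (2 * T + 2 + T * (2 * La + 2)) := by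
          rw [length_boolPair, OracleComposition.length_listBool_encode]
          have hsum : (as.map fun a => 2 * a.length + 2).sum ≤ as.length * (2 * La + 2) := by
            have : ∀ l : List (List Bool), (∀ a ∈ l, a.length ≤ La) → (l.map fun a => 2 * a.length + 2).sum ≤ l.length * (2 * La + 2) := by
              intro l hl
              induction l with
              | nil => simp
              | cons a l ih =>
                rw [List.map_cons, List.sum_cons, List.length_cons, add_mul, one_mul]
                have := hl a (by simp); have := ih fun b hb => hl b (by simp [hb]); omega
            exact this as has
          have hT : as.length * (2 * La + 2) ≤ T * (2 * La + 2) := Nat.mul_le_mul_right _ (by omega)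
          omega
        have := TM2Iter.eval_mono R h3
        omega
      · exact length_le_of_mem_queriesIdxAux M hR O hO x k (as ++ [O as.length y]) (by simp; omega)
          (fun a ha => by
            rcases List.mem_append.1 ha with ha | ha
            · exact has a ha
            · rw [List.mem_singleton.1 ha]; exact hO _ (by omega) _) q hq

/-! ### Well-formed tables -/

/-- A table of blocks is well formed at level `n` for `T` paths: it has at least `1 + 2n·T` entries, and those have
length `≥ pG(n)` (so every node key the attack meets is a key of `G(1ⁿ)`). [folklore] -/
def GoodTab (P : Spec) (n T : ℕ) (blocks : List (List Bool)) : Prop :=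
  1 + 2 * n * T ≤ blocks.length ∧ ∀ j < 1 + 2 * n * T, ∀ (hj : j < blocks.length), P.pG.eval n ≤ (blocks[j]).length

/-- The key of a block of length `≥ pG(n)` is in the range of `G(1ⁿ)`. [folklore] -/
theorem keyOf_mem_support_of_le (hW : P.WF) {n : ℕ} {b : List Bool} (hb : P.pG.eval n ≤ b.length) : keyOf P n b ∈ (P.S.keyPMF n).support := by
  refine SigOWF.FParams.mem_support_keyPMF P.S n _ ?_
  rw [List.length_take, hW.hcG, min_eq_left hb]

/-- One-time signatures at nodes of long enough blocks are short. [folklore] -/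
theorem length_signOf_le (hW : P.WF) {B : Bounds} (hB : B.OK P 𝒜) {n : ℕ} {b : List Bool} (hb : P.pG.eval n ≤ b.length) (m : List Bool) :
    (signOf P n b m).length ≤ B.PS.eval n :=
  hB.hPS n _ (keyOf_mem_support_of_le hW hb) m _ (by rw [coinsOf, length_fitLen, hW.hcS]; rfl)

/-- Positions of path labels lie in a well-formed table. [folklore] -/
theorem pos_lt_of_mem (n i : ℕ) {T : ℕ} (hi : i < T) (σ : List Bool) (hσ : σ.length = n) {L : List Bool} (hL : L = [] ∨ L ∈ pathLabels σ) :
    pos n i L < 1 + 2 * n * T := by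
  rcases hL with rfl | hL
  · simp [pos]
  · obtain ⟨t, ht, rfl⟩ := List.getElem_of_mem hL
    rw [pos_getElem_pathLabels n i σ t ht]
    rw [length_pathLabels, hσ] at ht
    have : i * (2 * n) + 2 * n ≤ (T - 1) * (2 * n) + 2 * n := by
      have := Nat.mul_le_mul_right (2 * n) (Nat.le_sub_one_of_lt hi); omega
    have h2 : (T - 1) * (2 * n) + 2 * n = 2 * n * T := by
      cases T with
      | zero => omega
      | succ T => simp [Nat.add_mul, Nat.mul_comm]
    omega

/-- In a well-formed table, the block of every label the attack meets on path `i < T` is long enough. [folklore] -/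
theorem length_tabFun_ge {n T : ℕ} {blocks : List (List Bool)} (hT : GoodTab P n T blocks) {i : ℕ} (hi : i < T) (σ : List Bool)
    (hσ : σ.length = n) {L : List Bool} (hL : L = [] ∨ L ∈ pathLabels σ) : P.pG.eval n ≤ (tabFun n i blocks L).length := by
  have hp := pos_lt_of_mem n i hi σ hσ hL
  rw [tabFun, List.getD_eq_getElem _ _ (hp.trans_le hT.1)]
  exact hT.2 _ hp _

/-- Prefixes of the leaf are nodes the attack meets. [folklore] -/
theorem take_mem_pathLabels (σ : List Bool) {j : ℕ} (hj : j < σ.length) : σ.take (j + 1) ∈ pathLabels σ := by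
  have ht : 2 * j + (if σ[j] then 1 else 0) < (pathLabels σ).length := by rw [length_pathLabels]; split <;> omega
  have h := getElem_pathLabels σ _ ht
  have hdiv : (2 * j + (if σ[j] then 1 else 0)) / 2 = j := by split_ifs <;> omega
  have hmod : decide ((2 * j + (if σ[j] then 1 else 0)) % 2 = 1) = σ[j] := by cases σ[j] <;> simp
  rw [hdiv, hmod, ← List.take_succ_eq_append_getElem hj] at h
  rw [← h]; exact List.getElem_mem _

/-- A prefix of the leaf is the root or a node the attack meets. [folklore] -/
theorem prefix_mem (σ pre σ' : List Bool) (h : pre ++ σ' = σ) : pre = [] ∨ pre ∈ pathLabels σ := by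
  rcases pre.eq_nil_or_concat with rfl | ⟨L, b, rfl⟩
  · exact Or.inl rfl
  · right
    simp only [List.concat_eq_append] at h ⊢
    have hj : L.length < σ.length := by rw [← h]; simp
    have : σ.take (L.length + 1) = L ++ [b] := by rw [← h]; simp [List.take_append]
    rw [← this]
    exact take_mem_pathLabels σ hj

/-! ### The node interface over a table: congruence and bounds -/

/-- `chainItems` only reads keys on the path's children and signs at the path's nodes. [folklore] -/
theorem chainItems_congr {pkN pkN' : List Bool → List Bool} {sgN sgN' : List Bool → List Bool → List Bool} :
    ∀ (pre σ : List Bool), (∀ L ∈ pathLabelsFrom pre σ, pkN L = pkN' L) → (∀ j ≤ σ.length, ∀ m, sgN (pre ++ σ.take j) m = sgN' (pre ++ σ.take j) m) →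
      chainItems pkN sgN pre σ = chainItems pkN' sgN' pre σ
  | _, [], _, _ => rfl
  | pre, b :: σ, hpk, hsg => by
    have h0 := hpk (pre ++ [false]) (by simp [pathLabelsFrom])
    have h1 := hpk (pre ++ [true]) (by simp [pathLabelsFrom])
    have hs := hsg 0 (Nat.zero_le _)
    simp only [List.take_zero, List.append_nil] at hs
    rw [chainItems, chainItems, h0, h1, hs]
    congr 1; congr 1; congr 1
    exact chainItems_congr (pre ++ [b]) σ (fun L hL => hpk L (by simp [pathLabelsFrom, hL]))
      (fun j hj m => by
        have := hsg (j + 1) (by simpa using hj) m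
        simpa [List.take_succ_cons, List.append_assoc] using this)

/-- **`sigG` only reads the table at the root and at the labels along the leaf.** [folklore] -/
theorem sigG_congr (n : ℕ) {Tab Tab' : List Bool → List Bool} {σ : List Bool} (h0 : Tab [] = Tab' [])
    (h : ∀ L ∈ pathLabels σ, Tab L = Tab' L) (α : List Bool) : sigG P n Tab α σ = sigG P n Tab' α σ := by
  have hsg : ∀ j ≤ σ.length, ∀ m, signOf P n (Tab ([] ++ σ.take j)) m = signOf P n (Tab' ([] ++ σ.take j)) m := by
    intro j hj m
    rw [List.nil_append]
    rcases Nat.eq_zero_or_pos j with rfl | hpos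
    · rw [List.take_zero, h0]
    · obtain ⟨j, rfl⟩ := Nat.exists_eq_succ_of_ne_zero hpos.ne'
      rw [h _ (take_mem_pathLabels σ (by omega))]
  rw [sigG, sigG, sigGI, sigGI, chainG, chainG,
    chainItems_congr (pkN' := fun L => pkOf P n (Tab' L)) (sgN' := fun L m => signOf P n (Tab' L) m) [] σ (fun L hL => by rw [h L hL]) hsg]
  have := hsg σ.length le_rfl α
  simp only [List.nil_append, List.take_length] at this ⊢
  rw [this]

/-- **The table signer is short on paths `i < T`** of a well-formed table (leaf of full length). [folklore] -/
theorem length_sigG_tabFun_le (hW : P.WF) {B : Bounds} (hB : B.OK P 𝒜) {n T : ℕ} {blocks : List (List Bool)} (hT : GoodTab P n T blocks)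
    {i : ℕ} (hi : i < T) {σ : List Bool} (hσ : σ.length = n) (α : List Bool) :
    (sigG P n (tabFun n i blocks) α σ).length ≤ B.Lsig.eval n := by
  classical
  -- replace the signing interface by one that is short everywhere and agrees on the path
  set sgN' : List Bool → List Bool → List Bool := fun L m => if L = [] ∨ L ∈ pathLabels σ then signOf P n (tabFun n i blocks L) m else [] with hsgN'
  have heq : sigG P n (tabFun n i blocks) α σ = sigGI (fun L => pkOf P n (tabFun n i blocks L)) sgN' α σ := by
    have hsg : ∀ j ≤ σ.length, ∀ m, signOf P n (tabFun n i blocks ([] ++ σ.take j)) m = sgN' ([] ++ σ.take j) m := by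
      intro j hj m
      rw [hsgN', List.nil_append]
      dsimp only
      rw [if_pos (prefix_mem σ _ (σ.drop j) (List.take_append_drop j σ))]
    rw [sigG, sigGI, sigGI, chainG, chainG, chainItems_congr (pkN' := fun L => pkOf P n (tabFun n i blocks L)) (sgN' := sgN') [] σ (fun L _ => rfl) hsg]
    have := hsg σ.length le_rfl α
    simp only [List.nil_append, List.take_length] at this ⊢
    rw [this]
  rw [heq]
  refine length_sigGI_le B (fun L => hB.hA n _) (fun L m => ?_) α hσ.le
  rw [hsgN']
  dsimp only
  split_ifs with hL
  · exact length_signOf_le hW hB (length_tabFun_ge hT hi σ hσ hL) m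
  · simp

/-- The pieces of the chain loop over a well-formed table, along a path `i < T`, are shorter than the clip. [folklore] -/
theorem pieceZ_tab_le (hW : P.WF) {B : Bounds} (hB : B.OK P 𝒜) {n T : ℕ} {blocks : List (List Bool)} (hT : GoodTab P n T blocks)
    {i : ℕ} (hi : i < T) {σ : List Bool} (hσ : σ.length = n) (α cnt σ' pre acc : List Bool) (_hne : σ' ≠ []) (hpre : pre ++ σ' = σ) :
    (pieceZ (pkF₀ P blkTF) (sgF₀ P blkTF) (boolPair (boolPair (sTab n i blocks) α) (boolPair cnt (boolPair σ' (boolPair pre acc))))).length ≤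
      B.PcOf.eval (boolPair (sTab n i blocks) α).length := by
  have hmono : B.PcOf.eval n ≤ B.PcOf.eval (boolPair (sTab n i blocks) α).length :=
    TM2Iter.eval_mono _ (by simp only [sTab, length_boolPair, List.length_replicate]; omega)
  refine le_trans ?_ hmono
  have h0 := hB.hA n (tabFun n i blocks (pre ++ [false]))
  have h1 := hB.hA n (tabFun n i blocks (pre ++ [true]))
  have hs := length_signOf_le hW hB (length_tabFun_ge hT hi σ hσ (prefix_mem σ pre σ' hpre))
    (boolPair (pkOf P n (tabFun n i blocks (pre ++ [false]))) (pkOf P n (tabFun n i blocks (pre ++ [true]))))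
  rw [pieceZ_apply, fstF_boolPair]
  simp only [encList_cons, encList_nil, length_boolPair, List.length_nil, pkF₀_blkTF, sgF₀_blkTF, Bounds.PcOf, eval_add, eval_mul, eval_ofNat]
  omega

/-! ### Indexed runs only read the oracle below the budget -/

section IdxCongr

open Literature.Computability.Complexity (OracleAlg)

variable {β : Type}

/-- The indexed run from a transcript of length `d` with `k` more rounds only consults `O i` for `d ≤ i < d + k`. [folklore] -/
theorem runIdxAux_congr_lt (M : OracleAlg β) {O O' : ℕ → List Bool → List Bool} (x : List Bool) :
    ∀ (k : ℕ) (as : List (List Bool)), (∀ i, as.length ≤ i → i < as.length + k → ∀ q, O i q = O' i q) →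
      M.runIdxAux O x k as = M.runIdxAux O' x k as
  | 0, _, _ => rfl
  | k + 1, as, h => by
    rw [OracleAlg.runIdxAux, OracleAlg.runIdxAux]
    cases M.step x as with
    | inr b => rfl
    | inl q =>
      dsimp only
      rw [h as.length le_rfl (by omega) q]
      exact runIdxAux_congr_lt M x k _ fun i hi hi' q' => h i (by simp at hi; omega) (by simp at hi'; omega) q'

/-- Likewise for the indexed transcript. [folklore] -/
theorem queriesIdxAux_congr_lt (M : OracleAlg β) {O O' : ℕ → List Bool → List Bool} (x : List Bool) :
    ∀ (k : ℕ) (as : List (List Bool)), (∀ i, as.length ≤ i → i < as.length + k → ∀ q, O i q = O' i q) →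
      M.queriesIdxAux O x k as = M.queriesIdxAux O' x k as
  | 0, _, _ => rfl
  | k + 1, as, h => by
    rw [OracleAlg.queriesIdxAux, OracleAlg.queriesIdxAux]
    cases M.step x as with
    | inr b => rfl
    | inl q =>
      dsimp only
      rw [h as.length le_rfl (by omega) q]
      congr 1
      exact queriesIdxAux_congr_lt M x k _ fun i hi hi' q' => h i (by simp at hi; omega) (by simp at hi'; omega) q'

/-- `runIdx` with budget `k` only consults `O i` for `i < k`. [folklore] -/
theorem runIdx_congr_lt (M : OracleAlg β) {O O' : ℕ → List Bool → List Bool} (k : ℕ) (x : List Bool) (h : ∀ i < k, ∀ q, O i q = O' i q) :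
    M.runIdx O k x = M.runIdx O' k x :=
  runIdxAux_congr_lt M x k [] fun i _ hi q => h i (by simpa using hi) q

/-- `queriesIdx` with budget `k` only consults `O i` for `i < k`. [folklore] -/
theorem queriesIdx_congr_lt (M : OracleAlg β) {O O' : ℕ → List Bool → List Bool} (k : ℕ) (x : List Bool) (h : ∀ i < k, ∀ q, O i q = O' i q) :
    M.queriesIdx O k x = M.queriesIdx O' k x :=
  queriesIdxAux_congr_lt M x k [] fun i _ hi q => h i (by simpa using hi) q

end IdxCongr

/-- **`ForgeWith` only reads the answering rule below the round budget.** [folklore] -/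
theorem forgeWith_congr {n : ℕ} (pk : List Bool) {O O' : ℕ → List Bool → List Bool} (h : ∀ i < TA P 𝒜 n, ∀ α, O i α = O' i α) (r : List Bool) :
    ForgeWith P 𝒜 n pk O r ↔ ForgeWith P 𝒜 n pk O' r := by
  rw [ForgeWith, ForgeWith, queriesIdx_congr_lt _ _ _ h, runIdx_congr_lt _ _ _ h]

/-! ### What the emulation computes -/

section Semantics

variable (P 𝒜)

/-- The table signer of the emulation: the `i`-th document is signed at the leaf `blk n i ρ` over the table read on path
`i`. [Goldreich 2004, proof of Prop. 6.4.17] [folklore] -/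
def OTab (n : ℕ) (blocks : List (List Bool)) (ρ : List Bool) : ℕ → List Bool → List Bool :=
  fun i α => sigG P n (tabFun n i blocks) α (Yao.blk n i ρ)

/-- The emulation input `⟨⟨1ⁿ, r⟩, listBool blocks⟩`. [folklore] -/
def wOf (n : ℕ) (r : List Bool) (blocks : List (List Bool)) : List Bool :=
  boolPair (boolPair (unaryEncodeNat n) r) ((encodingList Bool).listBool.encode blocks)

/-- The root key over the table. [folklore] -/
def pk0 (n : ℕ) (blocks : List (List Bool)) : List Bool := pkOf P n (blocks.getD 0 [])

/-- The forger's input over the table. [folklore] -/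
def xin (n : ℕ) (r : List Bool) (blocks : List (List Bool)) : List Bool := boolPair (xA P n (pk0 P n blocks)) (rA P 𝒜 n r)

variable {P 𝒜}

/-- The emulation input is at least as long as the security parameter. [folklore] -/
theorem le_length_wOf (n : ℕ) (r : List Bool) (blocks : List (List Bool)) : n ≤ (wOf n r blocks).length := by
  simp only [wOf, length_boolPair, Complexity.unaryEncodeNat_eq_replicate, List.length_replicate]; omega

/-- The root key over a well-formed table is short. [folklore] -/
theorem length_pk0_le (hW : P.WF) {n T : ℕ} {blocks : List (List Bool)} (hT : GoodTab P n T blocks) : (pk0 P n blocks).length ≤ P.PK.eval n := by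
  have h0 : 0 < blocks.length := lt_of_lt_of_le (by omega) hT.1
  have hb : P.pG.eval n ≤ (blocks.getD 0 []).length := by
    rw [List.getD_eq_getElem _ _ h0]; exact hT.2 0 (by omega) h0
  refine hW.hPK n _ ?_
  rw [List.length_take, min_eq_left hb]

/-- The forger's input over a well-formed table has the designed length. [folklore] -/
theorem length_xin (hW : P.WF) {n T : ℕ} {r : List Bool} {blocks : List (List Bool)} (hT : GoodTab P n T blocks) :
    (xin P 𝒜 n r blocks).length = 2 * ℓx P n + 2 + (rA P 𝒜 n r).length := by
  rw [xin, length_boolPair, length_xA P (length_pk0_le hW hT)]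

/-- **The answering rule IS the table signer** (with the echoed query) on paths `i < TA`. [folklore] -/
theorem ansD_eq_OTab (hW : P.WF) {B : Bounds} (hB : B.OK P 𝒜) {n : ℕ} {r : List Bool} {blocks : List (List Bool)}
    (hT : GoodTab P n (TA P 𝒜 n) blocks) (hρ : TA P 𝒜 n * n ≤ (ρD P 𝒜 n r).length) {i : ℕ} (hi : i < TA P 𝒜 n) (α : List Bool) :
    ansD P 𝒜 B.PcOf (boolPair (wOf n r blocks) (boolPair (unaryEncodeNat i) α)) = boolPair α (OTab P n blocks (ρD P 𝒜 n r) i α) := by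
  have hσ : (Yao.blk n i (ρD P 𝒜 n r)).length = n := Yao.length_blk_of_le (by nlinarith)
  exact ansD_apply n r blocks i α (by rw [hσ]; simp only [sTab, length_boolPair, List.length_replicate]; omega)
    fun cnt σ' pre acc hne hpre => pieceZ_tab_le hW hB hT hi hσ α cnt σ' pre acc hne hpre

/-- The table signer is short on paths `i < TA`. [folklore] -/
theorem length_OTab_le (hW : P.WF) {B : Bounds} (hB : B.OK P 𝒜) {n : ℕ} {blocks : List (List Bool)} {ρ : List Bool}
    (hT : GoodTab P n (TA P 𝒜 n) blocks) (hρ : TA P 𝒜 n * n ≤ ρ.length) {i : ℕ} (hi : i < TA P 𝒜 n) (α : List Bool) :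
    (OTab P n blocks ρ i α).length ≤ B.Lsig.eval n :=
  length_sigG_tabFun_le hW hB hT hi (Yao.length_blk_of_le (by nlinarith)) α

/-- The answer records over the queries `qᵢ, q_{i+1}, …`: `⟨qⱼ, O j qⱼ⟩`. [folklore] -/
def recordsOf (O : ℕ → List Bool → List Bool) : ℕ → List (List Bool) → List (List Bool)
  | _, [] => []
  | i, q :: qs => boolPair q (O i q) :: recordsOf O (i + 1) qs

/-- The records echo the queries. [folklore] -/
theorem map_fstF_recordsOf (O : ℕ → List Bool → List Bool) : ∀ (i : ℕ) (qs : List (List Bool)), (recordsOf O i qs).map fstF = qs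
  | _, [] => rfl
  | i, q :: qs => by rw [recordsOf, List.map_cons, fstF_boolPair, map_fstF_recordsOf O (i + 1) qs]

/-- The answers of an oracle answering tagged queries by records. [folklore] -/
theorem map_tagFrom_eq_recordsOf (Ow : Oracle) (O : ℕ → List Bool → List Bool) :
    ∀ (i : ℕ) (qs : List (List Bool)), (∀ j < qs.length, ∀ q, Ow (boolPair (unaryEncodeNat (i + j)) q) = boolPair q (O (i + j) q)) →
      (tagFrom i qs).map Ow = recordsOf O i qs
  | _, [], _ => rfl
  | i, q :: qs, h => by
    rw [tagFrom, List.map_cons, recordsOf, ← map_tagFrom_eq_recordsOf Ow O (i + 1) qs fun j hj q' => by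
      have := h (j + 1) (by simpa using hj) q'; rwa [show i + 1 + j = i + (j + 1) by omega]]
    have h0 := h 0 (by simp) q
    rw [Nat.add_zero] at h0
    rw [h0]

/-- **What the emulation computes.** On `w = ⟨⟨1ⁿ, r⟩, listBool blocks⟩` with a well-formed table and enough leaves (the
forger's coins of the designed length), the result is `⟨w_out, listBool records⟩`: the records `⟨αᵢ, OTab i αᵢ⟩` over
the queries of `𝒜` in the indexed attack against the table signer within `TA(n)` rounds, and `w_out` the code of its
output, or the time-out marker `[1]`. [Goldreich 2004, proof of Prop. 6.4.17 (the emulated attack)] [folklore] -/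
theorem resD_eq (hW : P.WF) {B : Bounds} (hB : B.OK P 𝒜) {n : ℕ} {r : List Bool} {blocks : List (List Bool)}
    (hT : GoodTab P n (TA P 𝒜 n) blocks) (hρ : TA P 𝒜 n * n ≤ (ρD P 𝒜 n r).length) :
    resD P 𝒜 B.PcOf (B.cOf P 𝒜) (Bounds.ROf P 𝒜) (wOf n r blocks) =
      boolPair (((𝒜.alg.runIdx (OTab P n blocks (ρD P 𝒜 n r)) (TA P 𝒜 n) (xin P 𝒜 n r blocks)).map ePair).getD [true])
        ((encodingList Bool).listBool.encode (recordsOf (OTab P n blocks (ρD P 𝒜 n r)) 0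
          (𝒜.alg.queriesIdx (OTab P n blocks (ρD P 𝒜 n r)) (TA P 𝒜 n) (xin P 𝒜 n r blocks)))) := by
  set w := wOf n r blocks with hw
  set O := OTab P n blocks (ρD P 𝒜 n r) with hO
  set Ow : Oracle := fun q' => ansD P 𝒜 B.PcOf (boolPair w q') with hOw
  set x₀ := xin P 𝒜 n r blocks with hx₀
  -- the answering rule is the table signer (with the echoed query) below the budget
  have hOw_apply : ∀ i < TA P 𝒜 n, ∀ α, Ow (boolPair (unaryEncodeNat i) α) = boolPair α (O i α) := by
    intro i hi α
    rw [hOw]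
    dsimp only
    rw [hw, ansD_eq_OTab hW hB hT hρ hi]
  have hagree : ∀ i < TA P 𝒜 n, ∀ α, idxOracle (sndF ∘ Ow) i α = O i α := by
    intro i hi α
    rw [idxOracle, Function.comp_apply, hOw_apply i hi, sndF_boolPair]
  -- the emulated forger's input and clock
  have hx₀' : x₀ = boolPair (xA P n (pk0 P n blocks)) (rA P 𝒜 n r) := rfl
  have hpre : preD P 𝒜 w = x₀ := by rw [hw, wOf, preD_apply]; rfl
  have hTA : 𝒜.fuel.eval (xA P n (pk0 P n blocks)).length = TA P 𝒜 n := by rw [length_xA P (length_pk0_le hW hT), TA]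
  have hnw : n ≤ w.length := by rw [hw]; exact le_length_wOf n r blocks
  -- the genuine run of the emulated forger against `Ow`
  have hR : 𝒜.fuel.eval (xA P n (pk0 P n blocks)).length < (Bounds.ROf P 𝒜).eval w.length := by
    rw [hTA, Bounds.ROf, eval_add, eval_one]
    have h1 := TM2Iter.eval_mono (TAPoly P 𝒜) hnw
    rw [← TA_eq] at h1; omega
  have hrun := run_simMFst 𝒜.alg ePair 𝒜.fuel [true] sndF hOut Ow (xA P n (pk0 P n blocks)) (rA P 𝒜 n r) hR
  rw [hTA, ← hx₀'] at hrun
  have hqs : 𝒜.alg.queriesIdx (idxOracle (sndF ∘ Ow)) (TA P 𝒜 n) x₀ = 𝒜.alg.queriesIdx O (TA P 𝒜 n) x₀ := queriesIdx_congr_lt _ _ _ hagree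
  have hro : 𝒜.alg.runIdx (idxOracle (sndF ∘ Ow)) (TA P 𝒜 n) x₀ = 𝒜.alg.runIdx O (TA P 𝒜 n) x₀ := runIdx_congr_lt _ _ _ hagree
  rw [hqs, hro] at hrun
  have hlenqs : (𝒜.alg.queriesIdx O (TA P 𝒜 n) x₀).length ≤ TA P 𝒜 n := OracleAlg.length_queriesIdx_le _ _ _ _
  -- query lengths
  have hx₀len : x₀.length = 2 * ℓx P n + 2 + (rA P 𝒜 n r).length := by rw [hx₀]; exact length_xin hW hT
  have hrAle : (rA P 𝒜 n r).length ≤ cA P 𝒜 n := by rw [rA, List.length_take]; exact min_le_left _ _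
  have hqlen : ∀ q ∈ (EM 𝒜).queries Ow ((Bounds.ROf P 𝒜).eval w.length) (preD P 𝒜 w), q.length ≤ (B.cOf P 𝒜).eval w.length := by
    intro q hq
    rw [hpre, EM, hrun.2] at hq
    obtain ⟨j, hj, rfl⟩ := List.getElem_of_mem hq
    rw [getElem_tagFrom, Nat.zero_add, length_boolPair, Complexity.unaryEncodeNat_eq_replicate, List.length_replicate]
    rw [length_tagFrom] at hj
    have hjT : j < TA P 𝒜 n := hj.trans_le hlenqs
    have hq' : (𝒜.alg.queriesIdx O (TA P 𝒜 n) x₀)[j] ∈ 𝒜.alg.queriesIdxAux O x₀ (TA P 𝒜 n) [] := List.getElem_mem _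
    have hbound := length_le_of_mem_queriesIdxAux 𝒜.alg hB.hRA O (La := B.Lsig.eval n) (T := TA P 𝒜 n)
      (fun i hi q => length_OTab_le hW hB hT hρ hi q) x₀ (TA P 𝒜 n) [] (by simp) (by simp) _ hq'
    have hmono : (B.cOf P 𝒜).eval n ≤ (B.cOf P 𝒜).eval w.length := TM2Iter.eval_mono _ hnw
    refine le_trans ?_ hmono
    rw [Bounds.cOf, eval_add, eval_add, eval_mul, eval_ofNat, ← TA_eq, Bounds.Lq, eval_comp]
    have hin : 2 * x₀.length + 2 + (2 * TA P 𝒜 n + 2 + TA P 𝒜 n * (2 * B.Lsig.eval n + 2)) ≤ (B.Lstep P 𝒜).eval n := by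
      simp only [Bounds.Lstep, eval_add, eval_mul, eval_ofNat, ← ℓx_eq, Bounds.Lans, ← TA_eq, ← cA_eq]
      rw [hx₀len]
      omega
    have := TM2Iter.eval_mono B.RA hin
    omega
  -- the emulation result
  have hsim : resD P 𝒜 B.PcOf (B.cOf P 𝒜) (Bounds.ROf P 𝒜) w = hOut (boolPair x₀ (boolPair
      ((encodingList Bool).listBool.encode (answersOf Ow (𝒜.alg.queriesIdx O (TA P 𝒜 n) x₀)))
      (((𝒜.alg.runIdx O (TA P 𝒜 n) x₀).map ePair).getD [true]))) := by
    rw [resD]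
    refine simFn_eq_of_run ?_ hqlen
    rw [hpre, EM]
    exact hrun.1
  rw [hsim, hOut_apply, answersOf, map_tagFrom_eq_recordsOf Ow O 0 _ fun j hj q => by rw [Nat.zero_add]; exact hOw_apply j (hj.trans_le hlenqs) q]

/-- **What the distinguisher's test computes**: the forgery event of the indexed attack against the table signer.
[Goldreich 2004, Def. 6.1.2; proof of Prop. 6.4.17] [folklore] -/
theorem GD_eq (hW : P.WF) {B : Bounds} (hB : B.OK P 𝒜) {n : ℕ} {r : List Bool} {blocks : List (List Bool)}
    (hT : GoodTab P n (TA P 𝒜 n) blocks) (hρ : TA P 𝒜 n * n ≤ (ρD P 𝒜 n r).length)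
    [Decidable (ForgeWith P 𝒜 n (pk0 P n blocks) (OTab P n blocks (ρD P 𝒜 n r)) (rA P 𝒜 n r))] :
    GD P 𝒜 B.PcOf (B.cOf P 𝒜) (Bounds.ROf P 𝒜) (wOf n r blocks) =
      [decide (ForgeWith P 𝒜 n (pk0 P n blocks) (OTab P n blocks (ρD P 𝒜 n r)) (rA P 𝒜 n r))] := by
  rw [GD, Function.comp_apply, fanoutFn_apply, id, resD_eq hW hB hT hρ]
  unfold wOf
  rw [testF_apply, map_fstF_recordsOf]
  congr 1
  rw [Bool.eq_iff_iff, decide_eq_true_iff, forgeWith_iff, pk0, xin, pk0]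
  cases 𝒜.alg.runIdx (OTab P n blocks (ρD P 𝒜 n r)) (TA P 𝒜 n) (boolPair (xA P n (pkOf P n (blocks.getD 0 []))) (rA P 𝒜 n r)) with
  | none =>
    simp only [Option.map_none, Option.getD_none]
    constructor
    · intro h
      simp only [Bool.and_eq_true, decide_eq_true_eq] at h
      exact absurd h.1 (by decide)
    · rintro ⟨α, sig, h, -⟩; cases h
  | some p =>
    obtain ⟨α, sig⟩ := p
    simp only [Option.map_some, Option.getD_some, ePair, fstF_boolPair, sndF_boolPair, decide_true, Bool.true_and, Bool.and_eq_true,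
      Bool.not_eq_true', decide_eq_false_iff_not, Option.some.injEq, Prod.mk.injEq]
    constructor
    · rintro ⟨hv, hn⟩; exact ⟨α, sig, ⟨rfl, rfl⟩, hv, hn⟩
    · rintro ⟨α', sig', ⟨rfl, rfl⟩, hv, hn⟩; exact ⟨hv, hn⟩

end Semantics

/-! ### The run of the distinguisher against a block oracle -/

section Run

/-- The block assignment read off an oracle: `L ↦ O (code n L)`. [folklore] -/
def blkO (O : Oracle) (n : ℕ) : List Bool → List Bool := fun L => O (code n L)

/-- An oracle answering the codes of labels of length `≤ n` with blocks of length `≥ pG(n)` (any `(n+1)`-bit query is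
such a code, but only label codes are ever asked). [folklore] -/
def BlockOracle (P : Spec) (O : Oracle) (n : ℕ) : Prop := ∀ lab : List Bool, lab.length ≤ n → P.pG.eval n ≤ (O (code n lab)).length

variable {n : ℕ}

/-- Labels fetched in the rounds the attack can use are short. [folklore] -/
theorem length_labAt_le' (ρ : List Bool) {T j : ℕ} (hj : j < 1 + 2 * n * T) : (labAt n ρ j).length ≤ n := by
  rcases Nat.eq_zero_or_pos n with rfl | hn
  · have : j = 0 := by omega
    subst this; simp
  · exact length_labAt_le n ρ j hn

/-- **The fetched table is well formed** against a block oracle. [folklore] -/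
theorem goodTab_fetched {O : Oracle} (hO : BlockOracle P O n) (r : List Bool) : GoodTab P n (TA P 𝒜 n) (fetched P 𝒜 O n r) := by
  refine ⟨by unfold fetched; rw [List.length_map, List.length_range]; exact qD_le_nFetch P 𝒜 n r, fun j hj hj' => ?_⟩
  unfold fetched
  rw [List.getElem_map, List.getElem_range]
  exact hO _ (length_labAt_le' _ hj)

/-- **The table read on path `i < TA` IS the oracle's block assignment** on the root and along the leaf. [folklore] -/
theorem tabFun_fetched (O : Oracle) {r : List Bool} (hρ : TA P 𝒜 n * n ≤ (ρD P 𝒜 n r).length) {i : ℕ} (hi : i < TA P 𝒜 n) {L : List Bool}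
    (hL : L = [] ∨ L ∈ pathLabels (Yao.blk n i (ρD P 𝒜 n r))) : tabFun n i (fetched P 𝒜 O n r) L = blkO O n L := by
  have hσ : (i + 1) * n ≤ (ρD P 𝒜 n r).length := le_trans (Nat.mul_le_mul_right n hi) hρ
  have hp : pos n i L < 1 + 2 * n * TA P 𝒜 n := pos_lt_of_mem n i hi _ (Yao.length_blk_of_le hσ) hL
  have hp' : pos n i L < (fetched P 𝒜 O n r).length := by
    unfold fetched; rw [List.length_map, List.length_range]; exact hp.trans_le (qD_le_nFetch P 𝒜 n r)
  rw [tabFun, List.getD_eq_getElem _ _ hp']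
  unfold fetched
  rw [List.getElem_map, List.getElem_range, blkO]
  congr 2
  rcases hL with rfl | hL
  · simp [pos]
  · obtain ⟨t, ht, rfl⟩ := List.getElem_of_mem hL
    have htn : t < 2 * n := by rw [length_pathLabels, Yao.length_blk_of_le hσ] at ht; exact ht
    rw [pos_getElem_pathLabels n i _ t ht, labAt_pos n i _ hσ t htn]

/-- **The table signer over the fetched table IS the block-oracle signer** below the budget. [folklore] -/
theorem OTab_fetched (O : Oracle) {r : List Bool} (hρ : TA P 𝒜 n * n ≤ (ρD P 𝒜 n r).length) {i : ℕ} (hi : i < TA P 𝒜 n) (α : List Bool) :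
    OTab P n (fetched P 𝒜 O n r) (ρD P 𝒜 n r) i α = sigG P n (blkO O n) α (Yao.blk n i (ρD P 𝒜 n r)) :=
  sigG_congr n (tabFun_fetched O hρ hi (Or.inl rfl)) (fun _ hL => tabFun_fetched O hρ hi (Or.inr hL)) α

/-- The root key over the fetched table. [folklore] -/
theorem pk0_fetched (O : Oracle) (r : List Bool) : pk0 P n (fetched P 𝒜 O n r) = pkOf P n (blkO O n []) := by
  have h0 : 0 < (fetched P 𝒜 O n r).length := by
    unfold fetched; rw [List.length_map, List.length_range]; exact lt_of_lt_of_le (by omega) (qD_le_nFetch P 𝒜 n r)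
  rw [pk0, List.getD_eq_getElem _ _ h0]
  unfold fetched
  rw [List.getElem_map, List.getElem_range, labAt_zero, blkO]

variable (P 𝒜)

/-- The block-oracle signer: the `i`-th document signed at the leaf `blk n i ρ` with nodes `L ↦ O (code n L)`.
[Goldreich 2004, proof of Prop. 6.4.17] [folklore] -/
def OSig (O : Oracle) (n : ℕ) (ρ : List Bool) : ℕ → List Bool → List Bool := fun i α => sigG P n (blkO O n) α (Yao.blk n i ρ)

variable {P 𝒜}

/-- **The run of the distinguisher against a block oracle**: on `⟨1ⁿ, r⟩` with coins of the designed length it accepts iff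
the forger forges in the indexed attack whose nodes are read off the oracle and whose `i`-th leaf is the `i`-th block
of the leaf coins. [Goldreich 2004, proof of Prop. 6.4.17] [folklore] -/
theorem run_distinguisher (hW : P.WF) {B : Bounds} (hB : B.OK P 𝒜) {O : Oracle} (hO : BlockOracle P O n) {r : List Bool}
    (hr : r.length = (cDPoly P 𝒜).eval n) [Decidable (ForgeWith P 𝒜 n (pkOf P n (blkO O n [])) (OSig P O n (ρD P 𝒜 n r)) (rA P 𝒜 n r))] :
    (distinguisher P 𝒜 B.PcOf (B.cOf P 𝒜) (Bounds.ROf P 𝒜)).alg.run O ((fuelD P 𝒜).eval n) (boolPair (unaryEncodeNat n) r) =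
      some (decide (ForgeWith P 𝒜 n (pkOf P n (blkO O n [])) (OSig P O n (ρD P 𝒜 n r)) (rA P 𝒜 n r))) := by
  classical
  have hρ : TA P 𝒜 n * n ≤ (ρD P 𝒜 n r).length := by rw [ρD, List.length_drop, hr, cDPoly_eval]; omega
  have hT := goodTab_fetched (P := P) (𝒜 := 𝒜) hO r
  rw [distinguisher, run_DAlg P 𝒜 _ _ _ O n r (by rw [fuelD_eval P 𝒜 n hr]; exact Nat.lt_succ_self _), ← wOf, GD_eq hW hB hT hρ]
  simp only [List.headD_cons, Option.some.injEq]
  rw [pk0_fetched, decide_eq_decide]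
  exact forgeWith_congr _ (fun i hi α => OTab_fetched O hρ hi α) _

end Run

end TreeSig

end Literature.Computability.Cryptography
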